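import Literature.GroupTheory.CombinatorialGroupTheory.RibbonGraphEdgeDeletionTransport
import Literature.GroupTheory.CombinatorialGroupTheory.FreeGroupFreshGeneratorMoves
import Mathlib.SetTheory.Cardinal.Finite
import Mathlib.Data.Fin.VecNotation
import Mathlib.Tactic.FinCases
import HarnessLib

/-!
# Geometric free bases of one-vertex ribbon graphs: the structure, the base case, rotation

Topic `Literature/GroupTheory/CombinatorialGroupTheory`; continues the `RibbonGraph*` files.
A *geometric basis* of the one-vertex ribbon graph `(E, ρ)` with `m + 1` boundary cycles is a free
basis `A_i, B_i (i < g), C_k (k < m)` of `F(E)` — packaged as an isomorphism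
`β : F((Fin g × Bool) ⊕ Fin m) ≃* F(E)` — together with an enumeration `rep : Fin (m+1) → darts`
of the boundary cycles of `face ρ` such that the boundary word of cycle `k < m` is conjugate to
`C_k` and the boundary word of the last cycle is conjugate to `(∏_i [A_i, B_i] · C_0 ⋯ C_{m-1})⁻¹`
(`GeometricBasis`).  Equivalently: an isomorphism of the punctured surface group `Γ_{g, m+1}` with
`F(E)` carrying the cusp generators to conjugates of the boundary words (see
`RibbonGraphFaceSystems.lean`).  This is the combinatorial core of the classification of compact
orientable surfaces with boundary via fat graphs (e.g. Zieschang–Vogt–Coldewey LNM 835 §3.2–3.5;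
Mohar–Thomassen §3.4): every one-vertex ribbon graph with `|E| ≥ 1` edges has a geometric basis
with `2g + m = |E|` (`RibbonGraphGeometricBasisInduction.lean`).

Here: the structure; the base case `|E| = 1` (an annulus); adjoining a fresh edge letter to a
basis (`adjoinEquiv`); and ROTATION of the boundary enumeration (`rotate`: any boundary cycle can
be made the distinguished "last" one, at the price of conjugating the handle generators).
-/

namespace Literature.GroupTheory.CombinatorialGroupTheory

namespace RibbonGraph

open Equiv Equiv.Perm Function

universe u

/-! ### Words of a geometric basis -/

/-- Index type of a geometric basis: `g` handle pairs and `m` free boundary generators. [cite: ZieschangVogtColdewey1980, Prop. 3.2.4 (canonical normal form 3.2.6)] -/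
abbrev GBIndex (g m : ℕ) : Type := (Fin g × Bool) ⊕ Fin m

/-- `∏_{i<g} [a_i, b_i]` in the free group on `GBIndex g m`. [cite: ZieschangVogtColdewey1980, Prop. 3.2.4 (canonical normal form 3.2.6)] -/
def handleWord (g m : ℕ) : FreeGroup (GBIndex g m) :=
  (List.ofFn fun i : Fin g =>
    FreeGroup.of (Sum.inl (i, true) : GBIndex g m) * FreeGroup.of (Sum.inl (i, false) : GBIndex g m) *
      (FreeGroup.of (Sum.inl (i, true) : GBIndex g m))⁻¹ *
        (FreeGroup.of (Sum.inl (i, false) : GBIndex g m))⁻¹).prod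

/-- `c_0 ⋯ c_{m-1}` in the free group on `GBIndex g m`. [cite: ZieschangVogtColdewey1980, Prop. 3.2.4 (canonical normal form 3.2.6)] -/
def boundaryWord (g m : ℕ) : FreeGroup (GBIndex g m) :=
  (List.ofFn fun k : Fin m => FreeGroup.of (Sum.inr k : GBIndex g m)).prod

/-- The surface word `∏_{i<g} [a_i, b_i] · c_0 ⋯ c_{m-1}`. [cite: ZieschangVogtColdewey1980, Prop. 3.2.4 (canonical normal form 3.2.6)] -/
def surfaceWord (g m : ℕ) : FreeGroup (GBIndex g m) := handleWord g m * boundaryWord g m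

/-- `handleWord_mem_genSubgroup`: bookkeeping lemma of this construction (see the module docstring). [cite: ZieschangVogtColdewey1980, Prop. 3.2.4 (canonical normal form 3.2.6)] -/
theorem handleWord_mem_genSubgroup (g m : ℕ) :
    handleWord g m ∈ genSubgroup (Set.range (Sum.inl : Fin g × Bool → GBIndex g m)) := by
  unfold handleWord
  refine Subgroup.list_prod_mem _ fun x hx => ?_
  rw [List.mem_ofFn] at hx
  obtain ⟨i, rfl⟩ := hx
  have ha : (FreeGroup.of (Sum.inl (i, true) : GBIndex g m)) ∈
      genSubgroup (Set.range (Sum.inl : Fin g × Bool → GBIndex g m)) := of_mem_genSubgroup ⟨_, rfl⟩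
  have hb : (FreeGroup.of (Sum.inl (i, false) : GBIndex g m)) ∈
      genSubgroup (Set.range (Sum.inl : Fin g × Bool → GBIndex g m)) := of_mem_genSubgroup ⟨_, rfl⟩
  exact mul_mem (mul_mem (mul_mem ha hb) (inv_mem ha)) (inv_mem hb)

/-- `boundaryWord_succ`: bookkeeping lemma of this construction (see the module docstring). [cite: ZieschangVogtColdewey1980, Prop. 3.2.4 (canonical normal form 3.2.6)] -/
theorem boundaryWord_succ (g m : ℕ) :
    boundaryWord g (m + 1) = (List.ofFn fun k : Fin m =>
      FreeGroup.of (Sum.inr k.castSucc : GBIndex g (m + 1))).prod *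
        FreeGroup.of (Sum.inr (Fin.last m)) := by
  rw [boundaryWord, List.ofFn_succ', List.concat_eq_append, List.prod_append, List.prod_singleton]

/-- `boundaryWord_succ_cons`: bookkeeping lemma of this construction (see the module docstring). [cite: ZieschangVogtColdewey1980, Prop. 3.2.4 (canonical normal form 3.2.6)] -/
theorem boundaryWord_succ_cons (g m : ℕ) :
    boundaryWord g (m + 1) = FreeGroup.of (Sum.inr 0 : GBIndex g (m + 1)) *
      (List.ofFn fun k : Fin m => FreeGroup.of (Sum.inr k.succ : GBIndex g (m + 1))).prod := by
  rw [boundaryWord, List.ofFn_succ, List.prod_cons]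

/-! ### The structure -/

variable {E : Type u}

/-- A **geometric basis** of the one-vertex ribbon graph `(E, ρ)` with `m + 1` boundary cycles:
a free basis `β` of `F(E)` indexed by `g` handle pairs and `m` boundary generators, an
enumeration `rep` of the boundary cycles of `face ρ` (one dart on each, `rep_surj`/`rep_inj`),
and conjugators `t` exhibiting the boundary word of cycle `k < m` as a conjugate of the `k`-th
boundary generator (`free_eq`) and that of the last cycle as a conjugate of the inverse surface
word (`last_eq`); `card_eq` records `2g + m = |E|`. [cite: ZieschangVogtColdewey1980, Prop. 3.2.4 (canonical normal form 3.2.6)] -/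
structure GeometricBasis [Finite E] (ρ : Perm (Dart E)) (g m : ℕ) where
  /-- the free basis, as an isomorphism from the free group on the index type -/
  β : FreeGroup (GBIndex g m) ≃* FreeGroup E
  /-- one dart on each boundary cycle; slot `Fin.last m` is the distinguished last cycle -/
  rep : Fin (m + 1) → Dart E
  /-- conjugators -/
  t : Fin (m + 1) → FreeGroup E
  rep_surj : ∀ x : Dart E, ∃ k, (face ρ).SameCycle (rep k) x
  rep_inj : ∀ k l, (face ρ).SameCycle (rep k) (rep l) → k = l
  free_eq : ∀ k : Fin m, t k.castSucc * cycleProd (face ρ) letter (rep k.castSucc) *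
    (t k.castSucc)⁻¹ = β (FreeGroup.of (Sum.inr k))
  last_eq : t (Fin.last m) * cycleProd (face ρ) letter (rep (Fin.last m)) * (t (Fin.last m))⁻¹ =
    (β (surfaceWord g m))⁻¹
  card_eq : 2 * g + m = Nat.card E

/-! ### The base case: one edge (an annulus) -/

section Base

variable [Finite E] [DecidableEq E]

omit [Finite E] [DecidableEq E] in
/-- A transitive rotation on the two darts of a single edge swaps them. [cite: ZieschangVogtColdewey1980, Prop. 3.2.4 (canonical normal form 3.2.6)] -/
theorem IsTransitive.apply_eq_flip_of_subsingleton {ρ : Perm (Dart E)} (hρ : IsTransitive ρ)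
    (hE : ∀ x y : E, x = y) (d : Dart E) : ρ d = flip d := by
  have h := hρ.apply_ne_self d
  rcases d with ⟨x, b⟩
  rcases hρd : ρ (x, b) with ⟨y, c⟩
  rw [hρd] at h
  obtain rfl := hE y x
  cases b <;> cases c <;> simp_all

omit [Finite E] [DecidableEq E] in
/-- The index type of the annulus basis is a singleton: identify it with the single edge.
[cite: ZieschangVogtColdewey1980, Prop. 3.2.4 (canonical normal form 3.2.6)] -/
def annulusIndexEquiv (e : E) (hE : ∀ x y : E, x = y) : GBIndex 0 1 ≃ E where
  toFun _ := e
  invFun _ := Sum.inr 0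
  left_inv x := by
    rcases x with ⟨⟨i, hi⟩, -⟩ | k
    · exact absurd hi (Nat.not_lt_zero i)
    · exact congrArg Sum.inr (Subsingleton.elim _ _)
  right_inv x := hE e x

omit [Finite E] [DecidableEq E] in
/-- `annulusIndexEquiv_apply`: bookkeeping lemma of this construction (see the module docstring). [cite: ZieschangVogtColdewey1980, Prop. 3.2.4 (canonical normal form 3.2.6)] -/
@[simp] theorem annulusIndexEquiv_apply (e : E) (hE : ∀ x y : E, x = y) (j : GBIndex 0 1) :
    annulusIndexEquiv e hE j = e := rfl

/-- The geometric basis of the annulus (`|E| = 1`): no handles, one free boundary generator `e`,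
boundary words `e` and `e⁻¹`. [cite: ZieschangVogtColdewey1980, Prop. 3.2.4 (canonical normal form 3.2.6)] -/
noncomputable def GeometricBasis.ofUnique (ρ : Perm (Dart E)) (hρ : IsTransitive ρ) (e : E)
    (hE : ∀ x y : E, x = y) : GeometricBasis ρ 0 1 where
  β := FreeGroup.freeGroupCongr (annulusIndexEquiv e hE)
  rep := ![(e, true), (e, false)]
  t _ := 1
  rep_surj := by
    rintro ⟨x, b⟩
    obtain rfl := hE x e
    cases b
    · exact ⟨1, SameCycle.rfl⟩
    · exact ⟨0, SameCycle.rfl⟩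
  rep_inj := by
    intro k l hkl
    have hfix : ∀ d : Dart E, face ρ d = d := fun d => by
      rw [face_apply, hρ.apply_eq_flip_of_subsingleton hE, flip_flip]
    have key : ∀ (d d' : Dart E), (face ρ).SameCycle d d' → d = d' := by
      intro d d' ⟨i, hi⟩
      rwa [zpow_apply_eq_self_of_apply_eq_self (hfix d)] at hi
    have h := key _ _ hkl
    fin_cases k <;> fin_cases l <;> simp_all
  free_eq := by
    intro k
    obtain rfl : k = 0 := Subsingleton.elim _ _
    have hper : minimalPeriod (face ρ) (e, true) = 1 := by
      rw [minimalPeriod_eq_one_iff_isFixedPt, IsFixedPt, face_apply,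
        hρ.apply_eq_flip_of_subsingleton hE, flip_flip]
    have h0 : (![(e, true), (e, false)] : Fin 2 → Dart E) (Fin.castSucc 0) = (e, true) := rfl
    rw [h0, cycleProd, hper, prodFrom_one, letter_true]
    simp
  last_eq := by
    have hper : minimalPeriod (face ρ) (e, false) = 1 := by
      rw [minimalPeriod_eq_one_iff_isFixedPt, IsFixedPt, face_apply,
        hρ.apply_eq_flip_of_subsingleton hE, flip_flip]
    have h1 : (![(e, true), (e, false)] : Fin 2 → Dart E) (Fin.last 1) = (e, false) := rfl
    rw [h1, cycleProd, hper, prodFrom_one, letter_false]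
    simp [surfaceWord, handleWord, boundaryWord]
  card_eq := by
    haveI : Unique E := ⟨⟨e⟩, fun x => hE x e⟩
    simp

end Base


/-! ### Products of generators under homomorphisms -/

section Words

variable {G : Type*} [Group G] (g m : ℕ)

/-- A homomorphism that is `L`-conjugate to another on the handle generators is so on the handle
word. [cite: ZieschangVogtColdewey1980, Prop. 3.2.4 (canonical normal form 3.2.6)] -/
theorem map_handleWord_eq_conj (f f' : FreeGroup (GBIndex g m) →* G) (L : G)
    (h : ∀ ib : Fin g × Bool, f (FreeGroup.of (Sum.inl ib)) = L * f' (FreeGroup.of (Sum.inl ib)) * L⁻¹) :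
    f (handleWord g m) = L * f' (handleWord g m) * L⁻¹ := by
  have := eqOn_genSubgroup (f := f) (g := ((MulAut.conj L).toMonoidHom).comp f')
    (S := Set.range (Sum.inl : Fin g × Bool → GBIndex g m)) (by rintro _ ⟨ib, rfl⟩; simpa using h ib)
    (handleWord_mem_genSubgroup g m)
  simpa using this

/-- Two homomorphisms agreeing on the handle generators agree on the handle word. [cite: ZieschangVogtColdewey1980, Prop. 3.2.4 (canonical normal form 3.2.6)] -/
theorem map_handleWord_congr (f f' : FreeGroup (GBIndex g m) →* G)
    (h : ∀ ib : Fin g × Bool, f (FreeGroup.of (Sum.inl ib)) = f' (FreeGroup.of (Sum.inl ib))) :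
    f (handleWord g m) = f' (handleWord g m) := by
  simpa using map_handleWord_eq_conj g m f f' 1 (by simpa using h)

/-- The image of the boundary word is the ordered product of the images of the boundary
generators. [cite: ZieschangVogtColdewey1980, Prop. 3.2.4 (canonical normal form 3.2.6)] -/
theorem map_boundaryWord (f : FreeGroup (GBIndex g m) →* G) :
    f (boundaryWord g m) = (List.ofFn fun k : Fin m => f (FreeGroup.of (Sum.inr k))).prod := by
  rw [boundaryWord, map_list_prod, List.map_ofFn]; rfl

end Words

/-! ### Rotating the boundary enumeration -/

section Rotate

/-- The cyclic shift of slots: new slot `0` is the old last slot, new slot `k+1` is the old slot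
`k`. [cite: ZieschangVogtColdewey1980, Prop. 3.2.4 (canonical normal form 3.2.6)] -/
def rotSlot (m : ℕ) : Fin (m + 1) ≃ Fin (m + 1) where
  toFun i := Fin.cases (Fin.last m) (fun k => k.castSucc) i
  invFun j := Fin.lastCases 0 (fun k => k.succ) j
  left_inv i := by cases i using Fin.cases <;> simp
  right_inv j := by cases j using Fin.lastCases <;> simp

/-- `rotSlot_zero`: bookkeeping lemma of this construction (see the module docstring). [cite: ZieschangVogtColdewey1980, Prop. 3.2.4 (canonical normal form 3.2.6)] -/
@[simp] theorem rotSlot_zero (m : ℕ) : rotSlot m 0 = Fin.last m := by simp [rotSlot]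

/-- `rotSlot_succ`: bookkeeping lemma of this construction (see the module docstring). [cite: ZieschangVogtColdewey1980, Prop. 3.2.4 (canonical normal form 3.2.6)] -/
@[simp] theorem rotSlot_succ (m : ℕ) (k : Fin m) : rotSlot m k.succ = k.castSucc := by simp [rotSlot]

variable [Finite E] {ρ : Perm (Dart E)} {g m : ℕ}

/-- The change of basis used by `rotate` (index side): the old last boundary generator becomes
the inverse surface word, the handle generators are conjugated by it, and the boundary slots are
shifted cyclically. [cite: ZieschangVogtColdewey1980, Prop. 3.2.4 (canonical normal form 3.2.6)] -/
noncomputable def rotateAut (g m : ℕ) : FreeGroup (GBIndex g (m + 1)) ≃* FreeGroup (GBIndex g (m + 1)) :=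
  let Y : FreeGroup (GBIndex g (m + 1)) :=
    (handleWord g (m + 1) *
      (List.ofFn fun k : Fin m => FreeGroup.of (Sum.inr k.castSucc : GBIndex g (m + 1))).prod)⁻¹
  have hY : Y ∈ genAvoiding (Sum.inr (Fin.last m) : GBIndex g (m + 1)) := by
    refine inv_mem (mul_mem ?_ (Subgroup.list_prod_mem _ fun x hx => ?_))
    · refine Subgroup.closure_mono (Set.image_mono ?_) (handleWord_mem_genSubgroup g (m + 1))
      rintro _ ⟨ib, rfl⟩
      exact Sum.inl_ne_inr
    · rw [List.mem_ofFn] at hx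
      obtain ⟨k, rfl⟩ := hx
      refine of_mem_genAvoiding fun h => ?_
      exact (Fin.castSucc_lt_last k).ne (Sum.inr_injective h)
  have hP : (FreeGroup.of (Sum.inr (Fin.last m)) : FreeGroup (GBIndex g (m + 1))) ∈
      genSubgroup (Set.range (Sum.inl : Fin g × Bool → GBIndex g (m + 1)))ᶜ :=
    of_mem_genSubgroup fun ⟨_, h⟩ => Sum.inl_ne_inr h
  (FreeGroup.freeGroupCongr (Equiv.sumCongr (Equiv.refl _) (rotSlot m))).trans
    ((conjGensAut (Set.range (Sum.inl : Fin g × Bool → GBIndex g (m + 1)))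
        (FreeGroup.of (Sum.inr (Fin.last m))) hP).trans
      (invGenMulAut (Sum.inr (Fin.last m)) 1 Y (one_mem _) hY))

/-- `rotateAut_of_inr_zero`: bookkeeping lemma of this construction (see the module docstring). [cite: ZieschangVogtColdewey1980, Prop. 3.2.4 (canonical normal form 3.2.6)] -/
theorem rotateAut_of_inr_zero (g m : ℕ) :
    rotateAut g m (FreeGroup.of (Sum.inr 0)) = (surfaceWord g (m + 1))⁻¹ := by
  simp only [rotateAut, MulEquiv.trans_apply, FreeGroup.freeGroupCongr_apply, FreeGroup.map.of,
    Equiv.sumCongr_apply, Sum.map_inr, rotSlot_zero]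
  rw [conjGensAut_of_not_mem _ _ (by rintro ⟨_, h⟩; exact Sum.inl_ne_inr h), invGenMulAut_of_self, one_mul,
    surfaceWord, boundaryWord_succ]
  group

/-- `rotateAut_of_inr_succ`: bookkeeping lemma of this construction (see the module docstring). [cite: ZieschangVogtColdewey1980, Prop. 3.2.4 (canonical normal form 3.2.6)] -/
theorem rotateAut_of_inr_succ (g m : ℕ) (k : Fin m) :
    rotateAut g m (FreeGroup.of (Sum.inr k.succ)) = FreeGroup.of (Sum.inr k.castSucc) := by
  simp only [rotateAut, MulEquiv.trans_apply, FreeGroup.freeGroupCongr_apply, FreeGroup.map.of,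
    Equiv.sumCongr_apply, Sum.map_inr, rotSlot_succ]
  rw [conjGensAut_of_not_mem _ _ (by rintro ⟨_, h⟩; exact Sum.inl_ne_inr h),
    invGenMulAut_of_ne (fun h => (Fin.castSucc_lt_last k).ne (Sum.inr_injective h))]

/-- `rotateAut_of_inl`: bookkeeping lemma of this construction (see the module docstring). [cite: ZieschangVogtColdewey1980, Prop. 3.2.4 (canonical normal form 3.2.6)] -/
theorem rotateAut_of_inl (g m : ℕ) (ib : Fin g × Bool) :
    rotateAut g m (FreeGroup.of (Sum.inl ib)) =
      (surfaceWord g (m + 1))⁻¹ * FreeGroup.of (Sum.inl ib) * surfaceWord g (m + 1) := by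
  simp only [rotateAut, MulEquiv.trans_apply, FreeGroup.freeGroupCongr_apply, FreeGroup.map.of,
    Equiv.sumCongr_apply, Sum.map_inl, Equiv.refl_apply]
  rw [conjGensAut_of_mem _ _ (Set.mem_range_self ib), map_mul, map_mul, map_inv,
    invGenMulAut_of_self, invGenMulAut_of_ne Sum.inl_ne_inr, one_mul, surfaceWord, boundaryWord_succ]
  group

/-- The rotation automorphism sends the surface word to the inverse of the old last free
boundary generator. [cite: ZieschangVogtColdewey1980, Prop. 3.2.4 (canonical normal form 3.2.6)] -/
theorem rotateAut_surfaceWord (g m : ℕ) :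
    rotateAut g m (surfaceWord g (m + 1)) = (FreeGroup.of (Sum.inr (Fin.last m)))⁻¹ := by
  have hhw := map_handleWord_eq_conj g (m + 1) (rotateAut g m).toMonoidHom (MonoidHom.id _)
    (surfaceWord g (m + 1))⁻¹ (fun ib => by simpa using rotateAut_of_inl g m ib)
  simp only [MulEquiv.coe_toMonoidHom, MonoidHom.id_apply, inv_inv] at hhw
  have hbw : rotateAut g m (boundaryWord g (m + 1)) = (surfaceWord g (m + 1))⁻¹ *
      (List.ofFn fun k : Fin m => FreeGroup.of (Sum.inr k.castSucc : GBIndex g (m + 1))).prod := by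
    rw [boundaryWord_succ_cons, map_mul, rotateAut_of_inr_zero, map_list_prod, List.map_ofFn]
    congr 2
    exact List.ofFn_inj.mpr (funext fun k => by simp [rotateAut_of_inr_succ])
  have hsw : surfaceWord g (m + 1) = handleWord g (m + 1) *
      (List.ofFn fun k : Fin m => FreeGroup.of (Sum.inr k.castSucc : GBIndex g (m + 1))).prod *
        FreeGroup.of (Sum.inr (Fin.last m)) := by
    rw [surfaceWord, boundaryWord_succ, mul_assoc]
  calc rotateAut g m (surfaceWord g (m + 1))
      = rotateAut g m (handleWord g (m + 1)) * rotateAut g m (boundaryWord g (m + 1)) := by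
        rw [surfaceWord, map_mul]
    _ = (surfaceWord g (m + 1))⁻¹ * (handleWord g (m + 1) *
          (List.ofFn fun k : Fin m => FreeGroup.of (Sum.inr k.castSucc : GBIndex g (m + 1))).prod) := by
        rw [hhw, hbw]; group
    _ = (FreeGroup.of (Sum.inr (Fin.last m)))⁻¹ := by
        conv_lhs => rw [hsw]
        group

/-- **Rotation of the boundary enumeration.**  From a geometric basis with `m + 2` boundary
cycles one gets another one in which the old LAST cycle is the free slot `0`, the old free slot
`k` is the free slot `k + 1`, and the old free slot `m` is the new last cycle; the handle
generators get conjugated by the old last boundary word. [cite: ZieschangVogtColdewey1980, Prop. 3.2.4 (canonical normal form 3.2.6)] -/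
noncomputable def GeometricBasis.rotate (G : GeometricBasis ρ g (m + 1)) : GeometricBasis ρ g (m + 1) where
  β := (rotateAut g m).trans G.β
  rep i := G.rep (rotSlot (m + 1) i)
  t i := G.t (rotSlot (m + 1) i)
  rep_surj x := by
    obtain ⟨k, hk⟩ := G.rep_surj x
    exact ⟨(rotSlot (m + 1)).symm k, by simpa using hk⟩
  rep_inj k l h := (rotSlot (m + 1)).injective (G.rep_inj _ _ h)
  free_eq k := by
    cases k using Fin.cases with
    | zero =>
      rw [MulEquiv.trans_apply, rotateAut_of_inr_zero, map_inv]
      simpa using G.last_eq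
    | succ k =>
      rw [MulEquiv.trans_apply, rotateAut_of_inr_succ]
      have e1 : (rotSlot (m + 1)) k.succ.castSucc = k.castSucc.castSucc := by
        rw [← Fin.succ_castSucc, rotSlot_succ]
      simpa [e1] using G.free_eq k.castSucc
  last_eq := by
    have e1 : rotSlot (m + 1) (Fin.last (m + 1)) = (Fin.last m).castSucc := by
      rw [← Fin.succ_last, rotSlot_succ]
    simp only [e1]
    rw [MulEquiv.trans_apply, rotateAut_surfaceWord, map_inv, inv_inv]
    exact G.free_eq (Fin.last m)
  card_eq := G.card_eq

/-- The representatives of the rotated basis. [cite: ZieschangVogtColdewey1980, Prop. 3.2.4 (canonical normal form 3.2.6)] -/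
@[simp] theorem GeometricBasis.rotate_rep (G : GeometricBasis ρ g (m + 1)) (i : Fin (m + 2)) :
    G.rotate.rep i = G.rep (rotSlot (m + 1) i) := rfl

/-- After rotating, the new last cycle is the old free slot `Fin.last m`. [cite: ZieschangVogtColdewey1980, Prop. 3.2.4 (canonical normal form 3.2.6)] -/
theorem GeometricBasis.rotate_rep_last (G : GeometricBasis ρ g (m + 1)) :
    G.rotate.rep (Fin.last (m + 1)) = G.rep (Fin.last m).castSucc := by
  rw [G.rotate_rep, ← Fin.succ_last, rotSlot_succ]

/-- Any boundary cycle can be rotated into the last slot. [cite: ZieschangVogtColdewey1980, Prop. 3.2.4 (canonical normal form 3.2.6)] -/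
theorem GeometricBasis.exists_rep_last_sameCycle (G : GeometricBasis ρ g m) (i : Fin (m + 1)) :
    ∃ G' : GeometricBasis ρ g m, (face ρ).SameCycle (G'.rep (Fin.last m)) (G.rep i) := by
  cases m with
  | zero =>
    obtain rfl : i = Fin.last 0 := Fin.ext (by have := i.isLt; simp only [Fin.val_last]; omega)
    exact ⟨G, SameCycle.rfl⟩
  | succ m =>
    -- rotate `j` times, where `i = last - j`
    suffices h : ∀ (j : ℕ) (G : GeometricBasis ρ g (m + 1)) (i : Fin (m + 2)), (i : ℕ) + j = m + 1 →
        ∃ G' : GeometricBasis ρ g (m + 1), (face ρ).SameCycle (G'.rep (Fin.last (m + 1))) (G.rep i) from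
      h (m + 1 - i) G i (by omega)
    intro j
    induction j with
    | zero =>
      intro G i hi
      have : i = Fin.last (m + 1) := Fin.ext (by simpa using hi)
      subst this
      exact ⟨G, SameCycle.rfl⟩
    | succ j ih =>
      intro G i hi
      have hi' : (i : ℕ) < m + 1 := by omega
      -- one rotation moves slot `i` (which is `castSucc` of something) to slot `i + 1`
      set i' : Fin (m + 1) := ⟨i, hi'⟩ with hi'def
      have hii : i = i'.castSucc := Fin.ext rfl
      obtain ⟨G', hG'⟩ := ih G.rotate i'.succ (by simp [i']; omega)
      refine ⟨G', ?_⟩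
      rw [G.rotate_rep, rotSlot_succ, ← hii] at hG'
      exact hG'

end Rotate

end RibbonGraph

end Literature.GroupTheory.CombinatorialGroupTheory
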